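import Mathlib
import Summits.Ventures.PercRepro.TriangleCapMantelStability

/-!
# PercRepro — THE DEFICIT OF A BIPARTITE SPANNING GRAPH: `Σ deficit ≥ 2 N₀ (k − N₀ − 1)` for `N₀` missing cross
pairs (p3, gen 34; part 35)

For a graph whose every edge crosses between a vertex set `X` and its complement (a bipartite graph with parts
`X`, `Xᶜ`, spanning), write `N₀` for the number of non-adjacent pairs `(x, y) ∈ X × Xᶜ` (the edges missing from
`K_{X, Xᶜ}`).  The deficit of an edge `x y` is exactly `d_H(x) + d_H(y)` (the missing pairs at its ends), so the
ordered deficit sum is `2 (k N₀ − Σ_v d_H(v)²)` (`sum_deficit_eq_of_bipartite`), and two missing pairs share at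
most one vertex, so `Σ_v d_H(v)² ≤ N₀² + N₀` (`sum_sq_missing_le`).  Hence

* **`sum_deficit_ge_of_bipartite`** — `2 N₀ (k − N₀ − 1) ≤ Σ deficit`;
* **`sum_deg_sq_le_of_bipartite`** — `Σ_v d(v)² + N₀ (k − N₀ − 1) ≤ m·k`: the loss below the Mantel envelope grows
  with the number of missing cross pairs, `r(k − r − 1)` for `r` of them — the closed form of
  P3-TRIANGLE-CAP.md §10av on the complete-bipartite-minus-`H` graphs, with equality iff `H` is a star.

Axioms: standard.
-/

namespace PercRepro

namespace TriangleCap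

namespace C047

open Finset

variable {V : Type*} [Fintype V] [DecidableEq V]

/-- The missing cross pairs at `x` towards `Y`. -/
def miss (D : SimpleGraph V) [DecidableRel D.Adj] (Y : Finset V) (x : V) : ℕ :=
  (Y.filter (fun y => ¬ D.Adj x y)).card

/-- The missing cross pairs `(x, y) ∈ X × Y`, as a set. -/
def missing (D : SimpleGraph V) [DecidableRel D.Adj] (X Y : Finset V) : Finset (V × V) :=
  (X ×ˢ Y).filter (fun p => ¬ D.Adj p.1 p.2)

omit [Fintype V] [DecidableEq V] in
/-- `|missing X Y| = Σ_{x ∈ X} miss Y x`. -/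
theorem card_missing_left (D : SimpleGraph V) [DecidableRel D.Adj] (X Y : Finset V) :
    (missing D X Y).card = ∑ x ∈ X, miss D Y x := by
  unfold missing miss
  rw [card_filter, sum_product]
  apply sum_congr rfl
  intro x _
  rw [card_filter]

omit [Fintype V] [DecidableEq V] in
/-- `|missing X Y| = Σ_{y ∈ Y} |{x ∈ X : ¬ x ~ y}|`. -/
theorem card_missing_right (D : SimpleGraph V) [DecidableRel D.Adj] (X Y : Finset V) :
    (missing D X Y).card = ∑ y ∈ Y, (X.filter (fun x => ¬ D.Adj x y)).card := by
  unfold missing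
  rw [card_filter, sum_product_right]
  apply sum_congr rfl
  intro y _
  rw [card_filter]

omit [Fintype V] in
/-- The pairs of missing pairs with the same first coordinate number `Σ_x (miss x)²`. -/
theorem card_same_fst (D : SimpleGraph V) [DecidableRel D.Adj] (X Y : Finset V) :
    ((missing D X Y ×ˢ missing D X Y).filter (fun q => q.1.1 = q.2.1)).card =
      ∑ x ∈ X, miss D Y x * miss D Y x := by
  rw [card_filter, sum_product]
  have e : ∀ p ∈ missing D X Y, (∑ q ∈ missing D X Y, if p.1 = q.1 then 1 else 0) = miss D Y p.1 := by
    intro p hp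
    rw [← card_filter]
    unfold missing at hp ⊢
    rw [mem_filter, mem_product] at hp
    have e2 : ((X ×ˢ Y).filter (fun q => ¬ D.Adj q.1 q.2)).filter (fun q => p.1 = q.1) =
        (Y.filter (fun y => ¬ D.Adj p.1 y)).image (fun y => (p.1, y)) := by
      ext q
      simp only [mem_filter, mem_product, mem_image]
      constructor
      · rintro ⟨⟨⟨hq1, hq2⟩, hq3⟩, hq4⟩
        refine ⟨q.2, ⟨hq2, by rw [hq4]; exact hq3⟩, ?_⟩
        rw [hq4]
      · rintro ⟨y, ⟨hy1, hy2⟩, rfl⟩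
        exact ⟨⟨⟨hp.1.1, hy1⟩, hy2⟩, rfl⟩
    rw [e2, card_image_of_injective _ (fun a b h => (Prod.mk.inj h).2)]
    rfl
  rw [sum_congr rfl e]
  -- fibre over the first coordinate
  unfold missing
  rw [sum_filter, sum_product]
  apply sum_congr rfl
  intro x _
  dsimp only
  rw [← sum_filter, sum_const, smul_eq_mul]
  unfold miss
  ring

omit [Fintype V] in
/-- The pairs of missing pairs with the same second coordinate number `Σ_y |{x : ¬ x ~ y}|²`. -/
theorem card_same_snd (D : SimpleGraph V) [DecidableRel D.Adj] (X Y : Finset V) :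
    ((missing D X Y ×ˢ missing D X Y).filter (fun q => q.1.2 = q.2.2)).card =
      ∑ y ∈ Y, (X.filter (fun x => ¬ D.Adj x y)).card * (X.filter (fun x => ¬ D.Adj x y)).card := by
  rw [card_filter, sum_product]
  have e : ∀ p ∈ missing D X Y, (∑ q ∈ missing D X Y, if p.2 = q.2 then 1 else 0) =
      (X.filter (fun x => ¬ D.Adj x p.2)).card := by
    intro p hp
    rw [← card_filter]
    unfold missing at hp ⊢
    rw [mem_filter, mem_product] at hp
    have e2 : ((X ×ˢ Y).filter (fun q => ¬ D.Adj q.1 q.2)).filter (fun q => p.2 = q.2) =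
        (X.filter (fun x => ¬ D.Adj x p.2)).image (fun x => (x, p.2)) := by
      ext q
      simp only [mem_filter, mem_product, mem_image]
      constructor
      · rintro ⟨⟨⟨hq1, hq2⟩, hq3⟩, hq4⟩
        refine ⟨q.1, ⟨hq1, by rw [hq4]; exact hq3⟩, ?_⟩
        rw [hq4]
      · rintro ⟨x, ⟨hx1, hx2⟩, rfl⟩
        exact ⟨⟨⟨hx1, hp.1.2⟩, hx2⟩, rfl⟩
    rw [e2, card_image_of_injective _ (fun a b h => (Prod.mk.inj h).1)]
  rw [sum_congr rfl e]
  unfold missing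
  rw [sum_filter, sum_product_right]
  apply sum_congr rfl
  intro y _
  dsimp only
  rw [← sum_filter]
  have hc : ∑ _a ∈ X.filter (fun a => ¬ D.Adj a y), (X.filter (fun x => ¬ D.Adj x y)).card =
      (X.filter (fun a => ¬ D.Adj a y)).card * (X.filter (fun x => ¬ D.Adj x y)).card := by
    rw [sum_const, smul_eq_mul]
  exact hc

omit [Fintype V] in
/-- **Two missing pairs share at most one vertex:** `Σ_x (miss x)² + Σ_y (miss y)² ≤ N₀² + N₀`. -/
theorem sum_sq_missing_le (D : SimpleGraph V) [DecidableRel D.Adj] (X Y : Finset V) :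
    ∑ x ∈ X, miss D Y x * miss D Y x +
      ∑ y ∈ Y, (X.filter (fun x => ¬ D.Adj x y)).card * (X.filter (fun x => ¬ D.Adj x y)).card ≤
        (missing D X Y).card * (missing D X Y).card + (missing D X Y).card := by
  rw [← card_same_fst, ← card_same_snd]
  set M := missing D X Y with hM
  -- pairs with the same first coordinate and pairs with the same second coordinate: their union is inside
  -- `M × M`, their intersection is the diagonal
  have hunion : ((M ×ˢ M).filter (fun q => q.1.1 = q.2.1)).card +
      ((M ×ˢ M).filter (fun q => q.1.2 = q.2.2)).card =
      ((M ×ˢ M).filter (fun q => q.1.1 = q.2.1 ∨ q.1.2 = q.2.2)).card +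
        ((M ×ˢ M).filter (fun q => q.1.1 = q.2.1 ∧ q.1.2 = q.2.2)).card := by
    rw [filter_or, filter_and, card_union_add_card_inter]
  have h1 : ((M ×ˢ M).filter (fun q => q.1.1 = q.2.1 ∨ q.1.2 = q.2.2)).card ≤ M.card * M.card := by
    rw [← card_product]
    exact card_filter_le _ _
  have h2 : ((M ×ˢ M).filter (fun q => q.1.1 = q.2.1 ∧ q.1.2 = q.2.2)).card ≤ M.card := by
    have e : (M ×ˢ M).filter (fun q => q.1.1 = q.2.1 ∧ q.1.2 = q.2.2) = M.image (fun p => (p, p)) := by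
      ext q
      simp only [mem_filter, mem_product, mem_image]
      constructor
      · rintro ⟨⟨h1, h2⟩, h3, h4⟩
        refine ⟨q.1, h1, ?_⟩
        have : q.1 = q.2 := Prod.ext h3 h4
        exact Prod.ext rfl this
      · rintro ⟨p, hp, rfl⟩
        exact ⟨⟨hp, hp⟩, rfl, rfl⟩
    rw [e]
    exact card_image_le
  omega

/-- In a bipartite spanning graph with parts `X`, `Xᶜ`, the deficit of an edge `x y` (`x ∈ X`) is
`miss x + |{x′ ∈ X : ¬ x′ ~ y}|`. -/
theorem deficit_eq_of_bipartite (D : SimpleGraph V) [DecidableRel D.Adj] (X : Finset V)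
    (hbip : ∀ x y, D.Adj x y → (x ∈ X ↔ y ∉ X)) {x y : V} (hxy : D.Adj x y) (hx : x ∈ X) :
    deficit D (x, y) = miss D Xᶜ x + (X.filter (fun x' => ¬ D.Adj x' y)).card := by
  unfold deficit miss
  have hy : y ∉ X := (hbip x y hxy).mp hx
  have e : univ.filter (fun z => ¬ D.Adj x z ∧ ¬ D.Adj y z) =
      (Xᶜ.filter (fun z => ¬ D.Adj x z)) ∪ (X.filter (fun z => ¬ D.Adj z y)) := by
    ext z
    simp only [mem_filter, mem_univ, true_and, mem_union, mem_compl]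
    constructor
    · rintro ⟨h1, h2⟩
      by_cases hz : z ∈ X
      · exact Or.inr ⟨hz, fun h => h2 h.symm⟩
      · exact Or.inl ⟨hz, h1⟩
    · rintro (⟨hz, h1⟩ | ⟨hz, h2⟩)
      · exact ⟨h1, fun h => hy ((hbip y z h).mpr hz)⟩
      · exact ⟨fun h => ((hbip x z h).mp hx) hz, fun h => h2 h.symm⟩
  rw [e, card_union_of_disjoint]
  rw [disjoint_left]
  intro z h1 h2
  rw [mem_filter, mem_compl] at h1
  rw [mem_filter] at h2
  exact h1.1 h2.1


/-- The adjacent ordered pairs starting in `X` are the adjacent pairs of `X × Xᶜ`. -/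
theorem filter_fst_mem_eq (D : SimpleGraph V) [DecidableRel D.Adj] (X : Finset V)
    (hbip : ∀ x y, D.Adj x y → (x ∈ X ↔ y ∉ X)) :
    (adjPairsAll D).filter (fun p => p.1 ∈ X) = (X ×ˢ Xᶜ).filter (fun p => D.Adj p.1 p.2) := by
  ext p
  simp only [mem_filter, mem_adjPairsAll, mem_product, mem_compl]
  constructor
  · rintro ⟨h1, h2⟩
    exact ⟨⟨h2, (hbip _ _ h1).mp h2⟩, h1⟩
  · rintro ⟨⟨h1, _⟩, h3⟩
    exact ⟨h3, h1⟩

/-- The adjacent ordered pairs starting outside `X` are the adjacent pairs of `Xᶜ × X`. -/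
theorem filter_fst_not_mem_eq (D : SimpleGraph V) [DecidableRel D.Adj] (X : Finset V)
    (hbip : ∀ x y, D.Adj x y → (x ∈ X ↔ y ∉ X)) :
    (adjPairsAll D).filter (fun p => ¬ p.1 ∈ X) = (Xᶜ ×ˢ X).filter (fun p => D.Adj p.1 p.2) := by
  ext p
  simp only [mem_filter, mem_adjPairsAll, mem_product, mem_compl]
  constructor
  · rintro ⟨h1, h2⟩
    refine ⟨⟨h2, ?_⟩, h1⟩
    by_contra h3
    exact h2 ((hbip _ _ h1).mpr h3)
  · rintro ⟨⟨h1, _⟩, h3⟩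
    exact ⟨h3, h1⟩

omit [Fintype V] [DecidableEq V] in
/-- `Σ_{(x,y) ∈ X × Y adjacent} f x = Σ_x f x · |{y ∈ Y : x ~ y}|`. -/
theorem sum_adj_product_fst (D : SimpleGraph V) [DecidableRel D.Adj] (X Y : Finset V) (f : V → ℕ) :
    ∑ p ∈ (X ×ˢ Y).filter (fun p => D.Adj p.1 p.2), f p.1 =
      ∑ x ∈ X, f x * (Y.filter (fun y => D.Adj x y)).card := by
  rw [sum_filter, sum_product]
  apply sum_congr rfl
  intro x _
  dsimp only
  rw [← sum_filter]
  have hc : ∑ _a ∈ Y.filter (fun y => D.Adj x y), f x = (Y.filter (fun y => D.Adj x y)).card * f x := by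
    rw [sum_const, smul_eq_mul]
  rw [hc, mul_comm]

omit [Fintype V] [DecidableEq V] in
/-- `Σ_{(x,y) ∈ X × Y adjacent} g y = Σ_y g y · |{x ∈ X : x ~ y}|`. -/
theorem sum_adj_product_snd (D : SimpleGraph V) [DecidableRel D.Adj] (X Y : Finset V) (g : V → ℕ) :
    ∑ p ∈ (X ×ˢ Y).filter (fun p => D.Adj p.1 p.2), g p.2 =
      ∑ y ∈ Y, g y * (X.filter (fun x => D.Adj x y)).card := by
  rw [sum_filter, sum_product_right]
  apply sum_congr rfl
  intro y _
  dsimp only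
  rw [← sum_filter]
  have hc : ∑ _a ∈ X.filter (fun x => D.Adj x y), g y = (X.filter (fun x => D.Adj x y)).card * g y := by
    rw [sum_const, smul_eq_mul]
  rw [hc, mul_comm]

/-- **THE DEFICIT SUM OF A BIPARTITE SPANNING GRAPH:**
`Σ deficit + 2 (Σ_x miss x² + Σ_y miss y²) = 2 k N₀`. -/
theorem sum_deficit_add_eq_of_bipartite (D : SimpleGraph V) [DecidableRel D.Adj] (X : Finset V)
    (hbip : ∀ x y, D.Adj x y → (x ∈ X ↔ y ∉ X)) :
    ∑ p ∈ adjPairsAll D, deficit D p +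
      2 * (∑ x ∈ X, miss D Xᶜ x * miss D Xᶜ x +
        ∑ y ∈ Xᶜ, (X.filter (fun x => ¬ D.Adj x y)).card * (X.filter (fun x => ¬ D.Adj x y)).card) =
      2 * (Fintype.card V * (missing D X Xᶜ).card) := by
  -- split by the side of the first coordinate
  have hsplit := sum_filter_add_sum_filter_not (adjPairsAll D) (fun p => p.1 ∈ X) (deficit D)
  rw [filter_fst_mem_eq D X hbip, filter_fst_not_mem_eq D X hbip] at hsplit
  -- the pairs `X → Xᶜ`
  have h1 : ∑ p ∈ (X ×ˢ Xᶜ).filter (fun p => D.Adj p.1 p.2), deficit D p =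
      ∑ p ∈ (X ×ˢ Xᶜ).filter (fun p => D.Adj p.1 p.2),
        (miss D Xᶜ p.1 + (X.filter (fun x => ¬ D.Adj x p.2)).card) := by
    apply sum_congr rfl
    intro p hp
    rw [mem_filter, mem_product] at hp
    exact deficit_eq_of_bipartite D X hbip hp.2 hp.1.1
  -- the pairs `Xᶜ → X`
  have h2 : ∑ p ∈ (Xᶜ ×ˢ X).filter (fun p => D.Adj p.1 p.2), deficit D p =
      ∑ p ∈ (Xᶜ ×ˢ X).filter (fun p => D.Adj p.1 p.2),
        (miss D Xᶜ p.2 + (X.filter (fun x => ¬ D.Adj x p.1)).card) := by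
    apply sum_congr rfl
    intro p hp
    rw [mem_filter, mem_product] at hp
    rw [deficit_swap]
    exact deficit_eq_of_bipartite D X hbip hp.2.symm hp.1.2
  rw [h1, h2, sum_add_distrib, sum_add_distrib] at hsplit
  have e1 : ∑ p ∈ (X ×ˢ Xᶜ).filter (fun p => D.Adj p.1 p.2), miss D Xᶜ p.1 =
      ∑ x ∈ X, miss D Xᶜ x * (Xᶜ.filter (fun y => D.Adj x y)).card :=
    sum_adj_product_fst D X Xᶜ (miss D Xᶜ)
  have e2 : ∑ p ∈ (X ×ˢ Xᶜ).filter (fun p => D.Adj p.1 p.2), (X.filter (fun x => ¬ D.Adj x p.2)).card =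
      ∑ y ∈ Xᶜ, (X.filter (fun x => ¬ D.Adj x y)).card * (X.filter (fun x => D.Adj x y)).card :=
    sum_adj_product_snd D X Xᶜ (fun y => (X.filter (fun x => ¬ D.Adj x y)).card)
  have e3 : ∑ p ∈ (Xᶜ ×ˢ X).filter (fun p => D.Adj p.1 p.2), miss D Xᶜ p.2 =
      ∑ x ∈ X, miss D Xᶜ x * (Xᶜ.filter (fun y => D.Adj x y)).card := by
    rw [sum_adj_product_snd]
    apply sum_congr rfl
    intro x _
    congr 2
    apply filter_congr
    intro y _
    exact ⟨fun h => h.symm, fun h => h.symm⟩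
  have e4 : ∑ p ∈ (Xᶜ ×ˢ X).filter (fun p => D.Adj p.1 p.2), (X.filter (fun x => ¬ D.Adj x p.1)).card =
      ∑ y ∈ Xᶜ, (X.filter (fun x => ¬ D.Adj x y)).card * (X.filter (fun x => D.Adj x y)).card := by
    have h := sum_adj_product_fst D Xᶜ X (fun y => (X.filter (fun x => ¬ D.Adj x y)).card)
    rw [h]
    apply sum_congr rfl
    intro y _
    congr 2
    apply filter_congr
    intro x _
    exact ⟨fun h => h.symm, fun h => h.symm⟩
  rw [e1, e2, e3, e4] at hsplit
  -- the complements inside `Xᶜ` and `X`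
  have h5 : ∀ x ∈ X, miss D Xᶜ x * (Xᶜ.filter (fun y => D.Adj x y)).card + miss D Xᶜ x * miss D Xᶜ x =
      miss D Xᶜ x * Xᶜ.card := by
    intro x _
    have := card_filter_add_card_filter_not (s := Xᶜ) (fun y => D.Adj x y)
    unfold miss
    rw [← Nat.mul_add, this]
  have h6 : ∀ y ∈ Xᶜ, (X.filter (fun x => ¬ D.Adj x y)).card * (X.filter (fun x => D.Adj x y)).card +
      (X.filter (fun x => ¬ D.Adj x y)).card * (X.filter (fun x => ¬ D.Adj x y)).card =
      (X.filter (fun x => ¬ D.Adj x y)).card * X.card := by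
    intro y _
    have := card_filter_add_card_filter_not (s := X) (fun x => D.Adj x y)
    rw [← Nat.mul_add, this]
  have s5 := sum_congr rfl h5
  have s6 := sum_congr rfl h6
  rw [sum_add_distrib, ← sum_mul, ← card_missing_left] at s5
  rw [sum_add_distrib, ← sum_mul, ← card_missing_right] at s6
  have hk := card_add_card_compl X
  -- assemble
  have e : (missing D X Xᶜ).card * Xᶜ.card + (missing D X Xᶜ).card * X.card =
      Fintype.card V * (missing D X Xᶜ).card := by rw [← hk]; ring
  omega

/-- **`2 N₀ (k − N₀ − 1) ≤ Σ deficit`** on a bipartite spanning graph with `N₀` missing cross pairs. -/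
theorem sum_deficit_ge_of_bipartite (D : SimpleGraph V) [DecidableRel D.Adj] (X : Finset V)
    (hbip : ∀ x y, D.Adj x y → (x ∈ X ↔ y ∉ X)) :
    2 * ((missing D X Xᶜ).card * (Fintype.card V - (missing D X Xᶜ).card - 1)) ≤
      ∑ p ∈ adjPairsAll D, deficit D p := by
  have h1 := sum_deficit_add_eq_of_bipartite D X hbip
  have h2 := sum_sq_missing_le D X Xᶜ
  set N := (missing D X Xᶜ).card with hN
  by_cases hkN : Fintype.card V ≤ N + 1
  · have : Fintype.card V - N - 1 = 0 := by omega
    rw [this]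
    simp
  · obtain ⟨j, hj⟩ : ∃ j, Fintype.card V = N + 1 + j := ⟨Fintype.card V - N - 1, by omega⟩
    have e : Fintype.card V - N - 1 = j := by omega
    rw [e]
    rw [hj] at h1
    nlinarith [h1, h2]

omit [Fintype V] in
/-- Bipartite spanning graphs are triangle-free. -/
theorem cliqueFree_of_bipartite (D : SimpleGraph V) [DecidableRel D.Adj] (X : Finset V)
    (hbip : ∀ x y, D.Adj x y → (x ∈ X ↔ y ∉ X)) : D.CliqueFree 3 := by
  intro S hS
  rw [SimpleGraph.is3Clique_iff] at hS
  obtain ⟨a, b, c, hab, hac, hbc, -⟩ := hS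
  have h1 := hbip a b hab
  have h2 := hbip a c hac
  have h3 := hbip b c hbc
  tauto

/-- **THE LOSS BELOW THE MANTEL ENVELOPE GROWS WITH THE MISSING CROSS PAIRS:**
`Σ_v d(v)² + N₀ (k − N₀ − 1) ≤ m·k` on a bipartite spanning graph with `N₀` missing cross pairs. -/
theorem sum_deg_sq_le_of_bipartite (D : SimpleGraph V) [DecidableRel D.Adj] (X : Finset V)
    (hbip : ∀ x y, D.Adj x y → (x ∈ X ↔ y ∉ X)) :
    ∑ v, deg D v * deg D v + (missing D X Xᶜ).card * (Fintype.card V - (missing D X Xᶜ).card - 1) ≤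
      D.edgeFinset.card * Fintype.card V := by
  have h1 := sum_deficit_ge_of_bipartite D X hbip
  have h2 := two_mul_sum_deg_sq_add_sum_deficit D
  rw [card_triangles3_eq_zero_of_cliqueFree D (cliqueFree_of_bipartite D X hbip)] at h2
  linarith

end C047

end TriangleCap

end PercRepro
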